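import Summits.Ventures.HSemireg.WedgeHankelRecurrenceGaussChebyshevOddResultant
import Summits.Ventures.HSemireg.WedgeHankelRecurrenceGaussChebyshevExample
import Summits.Ventures.HSemireg.WedgeHankelRecurrenceGaussChebyshevUExample

/-!
# Venture HSemireg — **THE GAUSS–CHEBYSHEV NODES OF THE FIRST AND SECOND KIND ARE UNIFORMLY `ℓ²`-CLOSE**: the two monic Chebyshev recurrences differ only in `b_1` (`1∕2` versus `1∕4`), so
# Hoffman–Wielandt (N417) gives, for EVERY number `t + 1` of nodes, **`Σ_{k≤t} (cos((k'+1)π∕(t+2)) − cos((2k'+1)π∕(2t+2)))² ≤ 2(√(1∕4) − √(1∕2))² = (3 − 2√2)∕2 < 9∕100`** (`k' = t − k`),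
# hence each increasing-ordered pair of nodes differs by at most `3∕10`

HONEST FRAMING. Part of the Lean index of the computation cell `pub-hsemireg` (seat p10 gen 47, Sunday typer «UNIFORM-IN-n»).  Real finite sums, `Real.cos`, `Real.sqrt` only; no variety, no
cohomology theory, no sheaf, no Ext group and no semiregularity map is constructed here; nothing here says that HC / HC_CM / HC_AV holds; no Literature fact (unproved `Prop`) is declared or used.
Custodian versions as in `WedgeHankelSiegelIdeal` (1/3).
SOURCES (cited).  A. J. Hoffman, H. W. Wielandt, Duke Math. J. 20 (1953) 37–39; G. H. Golub, J. H. Welsch, *Calculation of Gauss quadrature rules*, Math. Comp. 23 (1969) 221–230 (Jacobi-matrix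
model of the nodes); W. Gautschi, *Orthogonal Polynomials: Computation and Approximation* (2004), §3.1 (conditioning of the coefficient-to-node map); G. Szegő, *Orthogonal Polynomials*, (1.12.3),
§6.3 (the two node families).  The uniform bound is the COROLLARY typed here of N417.
PROOF TYPED HERE.  N417 `hoffman_wielandt_recurrence` with the chapter's recurrences `a ≡ 0`, `b = (·, 1∕2, 1∕4, 1∕4, …)` (N3xx `chebyshev_recurrence_eq_prod`, `chebyshev_nodes_strictMono`) and
`a ≡ 0`, `b ≡ 1∕4` (N3xx `chebyshevU_recurrence_eq_prod`, `chebyshevU_nodes_strictMono`), built by `recurrence_of_coefficients`; only the `i = 0` term of the `b`-sum survives.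
DEDUP DISCLOSURE (`rg -n -i 'nodes_hoffman|T_gt_U|nodes_close' Summits/Ventures/HSemireg`, 2026-09-04): N3xx `chebyshev_top_zero_T_gt_U` (top node comparison only); 0 hits for the 3 names
below.

WHAT IS IN THE TREE.  N417 `hoffman_wielandt_recurrence`; §1097 `chebyshev_recurrence_eq_prod`, `chebyshev_nodes_strictMono`; §1125 `chebyshevU_recurrence_eq_prod`, `chebyshevU_nodes_strictMono`,
`recurrence_of_coefficients`.
THIS FILE (namespace `Summit.Ventures.HSemireg.Wedge.HankelOuter` continued; CHAINED on N434 (import) plus the two Chebyshev example leaves; 0 definitions):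
* §1200 **`chebyshev_nodes_hoffman_wielandt`** (`≤ 2(√(1∕4) − √(1∕2))²`), `chebyshev_nodes_hoffman_wielandt_num` (`≤ 9∕100`), `chebyshev_nodes_sub_abs_le` (each pair `≤ 3∕10`).
CAVEATS.  Nodes in the chapter's increasing order (`Fin.rev`); uniform in `t`, not sharp for large `t`.  Nothing Ext-side.  New names only.
-/

open Module Polynomial Real
open scoped Matrix Polynomial

namespace Summit.Ventures.HSemireg.Wedge.HankelOuter

/-! ## §1200. First- versus second-kind Gauss–Chebyshev nodes, uniformly in the degree -/

/-- **`Σ_k (y_k − x_k)² ≤ 2(√(1∕4) − √(1∕2))²`** for the increasing-ordered zeros `x` of `T_{t+1}` and `y` of `U_{t+1}`, every `t`. [corollary of Hoffman–Wielandt 1953 via Golub–Welsch 1969;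
Gautschi §3.1; this file, §1200] -/
theorem chebyshev_nodes_hoffman_wielandt (t : ℕ) :
    ∑ k : Fin (t + 1), (cos ((((Fin.rev k : Fin (t + 1)) : ℝ) + 1) * π / ((t : ℝ) + 2)) - cos ((2 * ((Fin.rev k : Fin (t + 1)) : ℝ) + 1) * π / (2 * ((t : ℝ) + 1)))) ^ 2 ≤
      2 * (Real.sqrt (1 / 4) - Real.sqrt (1 / 2)) ^ 2 := by
  set bT : ℕ → ℝ := fun j => if j = 1 then 1 / 2 else 1 / 4 with hbT
  have hb1 : bT 1 = 1 / 2 := if_pos rfl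
  have hb2 : ∀ n : ℕ, bT (n + 2) = 1 / 4 := fun n => if_neg (by omega)
  have hb2' : ∀ n : ℕ, bT (n + 1 + 1) = 1 / 4 := fun n => if_neg (by omega)
  obtain ⟨q, hq0, hq1, hrec⟩ := recurrence_of_coefficients (fun _ => (0 : ℝ)) bT
  obtain ⟨q', hq0', hq1', hrec'⟩ := recurrence_of_coefficients (fun _ => (0 : ℝ)) (fun _ => (1 / 4 : ℝ))
  have hxq := chebyshev_recurrence_eq_prod (q := q) (a := fun _ => (0 : ℝ)) (b := bT) hq0 hq1 hrec (fun _ => rfl) hb1 hb2 t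
  have hyq := chebyshevU_recurrence_eq_prod (q := q') (a := fun _ => (0 : ℝ)) (b := fun _ => (1 / 4 : ℝ)) hq0' hq1' hrec' (fun _ => rfl) (fun _ => rfl) t
  have hbpos : ∀ j, 0 < bT j := fun j => by simp only [hbT]; split_ifs <;> norm_num
  have h := hoffman_wielandt_recurrence (q := q) (q' := q') (a := fun _ => (0 : ℝ)) (a' := fun _ => (0 : ℝ)) (b := bT) (b' := fun _ => (1 / 4 : ℝ))
    hq0 hq1 hrec hq0' hq1' hrec' hbpos (fun _ => by norm_num) (chebyshev_nodes_strictMono t) hxq (chebyshevU_nodes_strictMono t) hyq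
  refine h.trans ?_
  simp only [sub_self, zero_pow two_ne_zero, Finset.sum_const_zero, zero_add]
  cases t with
  | zero => rw [Finset.sum_range_zero, mul_zero]; positivity
  | succ t =>
    rw [Finset.sum_range_succ']
    simp only [hb2', hb1, sub_self, zero_pow two_ne_zero, Finset.sum_const_zero, zero_add]
    exact le_rfl

/-- **Numerically: `Σ_k (y_k − x_k)² ≤ 9∕100`** for every `t` (`(3 − 2√2)∕2 = 0.0857…`). [corollary; this file, §1200] -/
theorem chebyshev_nodes_hoffman_wielandt_num (t : ℕ) :
    ∑ k : Fin (t + 1), (cos ((((Fin.rev k : Fin (t + 1)) : ℝ) + 1) * π / ((t : ℝ) + 2)) - cos ((2 * ((Fin.rev k : Fin (t + 1)) : ℝ) + 1) * π / (2 * ((t : ℝ) + 1)))) ^ 2 ≤ 9 / 100 := by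
  refine (chebyshev_nodes_hoffman_wielandt t).trans ?_
  have h4 : Real.sqrt (1 / 4) = 1 / 2 := by rw [show (1 / 4 : ℝ) = (1 / 2) ^ 2 by norm_num, Real.sqrt_sq (by norm_num)]
  rw [h4]
  nlinarith [Real.sq_sqrt (show (0 : ℝ) ≤ 1 / 2 by norm_num), Real.sqrt_nonneg (1 / 2)]

/-- **Each increasing-ordered pair of first∕second-kind nodes differs by at most `3∕10`**, uniformly in the degree. [corollary; this file, §1200] -/
theorem chebyshev_nodes_sub_abs_le (t : ℕ) (k : Fin (t + 1)) :
    |cos ((((Fin.rev k : Fin (t + 1)) : ℝ) + 1) * π / ((t : ℝ) + 2)) - cos ((2 * ((Fin.rev k : Fin (t + 1)) : ℝ) + 1) * π / (2 * ((t : ℝ) + 1)))| ≤ 3 / 10 := by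
  have h := (Finset.single_le_sum (f := fun k : Fin (t + 1) =>
      (cos ((((Fin.rev k : Fin (t + 1)) : ℝ) + 1) * π / ((t : ℝ) + 2)) - cos ((2 * ((Fin.rev k : Fin (t + 1)) : ℝ) + 1) * π / (2 * ((t : ℝ) + 1)))) ^ 2)
    (fun k _ => sq_nonneg _) (Finset.mem_univ k)).trans (chebyshev_nodes_hoffman_wielandt_num t)
  exact abs_le_of_sq_le_sq (by simpa using h.trans (by norm_num : (9 / 100 : ℝ) ≤ (3 / 10) ^ 2)) (by norm_num)

end Summit.Ventures.HSemireg.Wedge.HankelOuter
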